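import Mathlib
import Literature.Analysis.PDE.GaussianBeam1DCutoff

/-!
# First-order Gaussian beams for `u_tt − u_xx + μ² q(x) u = 0`: Cauchy data of the cut rest
# beam, support, and the integrated size of its residual

Topic `Literature/Analysis/PDE` (namespace `Literature.Analysis.PDE`). Everything is proved; no
definitions. For the cut real beam `G(t,x) = χ(x − X t)·Re(a(t)e^{iμΦ(t,x)})` of
`GaussianBeam1DCutoff.lean`/`GaussianBeam1DEnergy.lean`:

* `cutBeam_eq_zero_of_le` — `G(t, x) = 0` once `|x − X t| ≥ δ₀`;
* `cutBeam_initial` — for REST data (`θ(0) = ξ(0) = 0`, `Γ(0) = iβ₀`, `a(0)` real) the datum is the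
  real Gaussian `G(0,x) = χ(x − X₀)·a(0)·e^{−μβ₀(x−X₀)²/2}`, and (`cutBeam_initial_deriv`) its
  time derivative VANISHES IDENTICALLY (`X′(0) = 0`, `Re a′(0) = 0`, `Im Γ′(0) = 0`, the values
  supplied by `Literature.Analysis.ODE.exists_beamPhase`): the cut rest beam has standing-start
  Cauchy data `(g, 0)`, so the exact solution with these data is even in time;
* `lintegral_ofReal_ge_of_le_on_Icc`, `cutBeam_initial_potential_ge` — on the window
  `|x − X₀| ≤ (μβ₀)^{−1/2}` (inside `{χ = 1}` once `μ ≥ 4/(β₀δ₀²)`) the potential energy density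
  `μ² q G(0,·)²` is at least `μ² q₀ a(0)² e^{−1}`, so the energy of the data is `≳ μ^{3/2}`;
* `cutBeam_residual_sq_le_indicator` — with the pointwise bound `|PG| ≤ B√μ` of
  `cutBeam_residual_pointwise`, `(PG)² ≤ B²μ·𝟙_{[X t − δ₀, X t + δ₀]}`, whose integral is `2δ₀B²μ`
  (`integral_const_indicator_Icc`): the `L²(dx)`-size of the residual is `O(μ)` while the energy is
  `≍ μ^{3/2}` — the input of the energy estimate for (true solution) − (beam).

## References

* J. Ralston, *Gaussian beams and the propagation of singularities*, MAA Stud. Math. 23 (1982)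
  206–248, §2. Key `Ralston1982`.
* J. Sbierski, Anal. PDE 8 (2015) 1379–1420, §§2–3 (arXiv:1311.2477v2 §2.2–2.3). Key `Sbierski2015`.
-/

noncomputable section

namespace Literature.Analysis.PDE

open Set Filter Topology Complex MeasureTheory

section Data

variable {q : ℝ → ℝ} {X ξ θ χ : ℝ → ℝ} {Γ a : ℝ → ℂ} {μ δ₀ : ℝ}

/-- The cut beam vanishes off the `δ₀`-neighbourhood of the ray. [folklore] -/
theorem cutBeam_eq_zero_of_le (hχ0 : ∀ y, δ₀ ≤ |y| → χ y = 0) {t x : ℝ} (h : δ₀ ≤ |x - X t|) :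
    χ (x - X t) * (a t * cexp (I * μ * ((θ t : ℂ) + (ξ t : ℂ) * ((x : ℂ) - X t)
      + Γ t / 2 * ((x : ℂ) - X t) ^ 2))).re = 0 := by
  rw [hχ0 _ h, zero_mul]

/-- **The datum of the cut rest beam is a real Gaussian**:
`G(0, x) = χ(x − X₀) · Re a(0) · e^{−μβ₀(x−X₀)²/2}` when `θ(0) = ξ(0) = 0`, `Γ(0) = iβ₀`.
[cite: Ralston1982, §2] -/
theorem cutBeam_initial {X₀ β₀ : ℝ} (hX0 : X 0 = X₀) (hξ0 : ξ 0 = 0) (hθ0 : θ 0 = 0)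
    (hΓ0 : Γ 0 = (β₀ : ℂ) * I) (x : ℝ) :
    χ (x - X 0) * (a 0 * cexp (I * μ * ((θ 0 : ℂ) + (ξ 0 : ℂ) * ((x : ℂ) - X 0)
        + Γ 0 / 2 * ((x : ℂ) - X 0) ^ 2))).re
      = χ (x - X₀) * (a 0).re * Real.exp (-(μ * β₀ * (x - X₀) ^ 2 / 2)) := by
  have harg : I * μ * ((θ 0 : ℂ) + (ξ 0 : ℂ) * ((x : ℂ) - X 0) + Γ 0 / 2 * ((x : ℂ) - X 0) ^ 2)
      = ((-(μ * β₀ * (x - X₀) ^ 2 / 2) : ℝ) : ℂ) := by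
    rw [hθ0, hξ0, hΓ0, hX0]
    push_cast
    ring_nf
    rw [Complex.I_sq]
    ring
  rw [harg, ← Complex.ofReal_exp, hX0, Complex.mul_re, Complex.ofReal_re, Complex.ofReal_im,
    mul_zero, sub_zero]
  ring

/-- **The cut rest beam has vanishing initial time derivative.** With rest data as in
`cutBeam_initial` and the values `X′(0) = 0`, `Re a′(0) = 0`, `Im Γ′(0) = 0` at `t = 0`
(`Literature.Analysis.ODE.exists_beamPhase`), `∂_t G(0, x) = 0` for every `x`.
[cite: Ralston1982, §2] -/
theorem cutBeam_initial_deriv {β₀ : ℝ} (hχ : ContDiff ℝ 2 χ) (hX : ContDiff ℝ 2 X)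
    (hξ : ContDiff ℝ 2 ξ) (hθ : ContDiff ℝ 2 θ) (hΓ : ContDiff ℝ 2 Γ) (ha : ContDiff ℝ 2 a)
    (hξ0 : ξ 0 = 0) (hθ0 : θ 0 = 0) (hΓ0 : Γ 0 = (β₀ : ℂ) * I) (ha0 : (a 0).im = 0)
    (hdX0 : deriv X 0 = 0) (hda0 : (deriv a 0).re = 0) (hdΓ0 : (deriv Γ 0).im = 0) (x : ℝ) :
    deriv (fun τ => χ (x - X τ) * (a τ * cexp (I * μ * ((θ τ : ℂ) + (ξ τ : ℂ) * ((x : ℂ) - X τ)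
      + Γ τ / 2 * ((x : ℂ) - X τ) ^ 2))).re) 0 = 0 := by
  have hX1 : ContDiff ℝ 1 X := hX.of_le (by norm_num)
  have hξ1 : ContDiff ℝ 1 ξ := hξ.of_le (by norm_num)
  have hθ1 : ContDiff ℝ 1 θ := hθ.of_le (by norm_num)
  have hΓ1 : ContDiff ℝ 1 Γ := hΓ.of_le (by norm_num)
  have ha1 : ContDiff ℝ 1 a := ha.of_le (by norm_num)
  -- the complex slice and its derivative at `t = 0`
  have hF := hasDerivAt_beam_t (μ := μ) hX1 hξ1 hθ1 hΓ1 ha1 x 0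
  have hu : HasDerivAt (fun τ => (a τ * cexp (I * μ * ((θ τ : ℂ) + (ξ τ : ℂ) * ((x : ℂ) - X τ)
      + Γ τ / 2 * ((x : ℂ) - X τ) ^ 2))).re) _ 0 :=
    Complex.reCLM.hasFDerivAt.comp_hasDerivAt 0 hF
  have hcut := hasDerivAt_cutoff_t hχ hX x 0
  have hprod : HasDerivAt (fun τ => χ (x - X τ) * (a τ * cexp (I * μ * ((θ τ : ℂ)
      + (ξ τ : ℂ) * ((x : ℂ) - X τ) + Γ τ / 2 * ((x : ℂ) - X τ) ^ 2))).re) _ 0 := hcut.mul hu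
  -- the factor `e^{iμΦ(0,x)}` is real and `a′(0) + iμΦ_t(0,x)a(0)` is purely imaginary
  set z : ℂ := (x : ℂ) - X 0 with hz
  have hzim : z.im = 0 := by simp [hz]
  have hE : (cexp (I * μ * ((θ 0 : ℂ) + (ξ 0 : ℂ) * z + Γ 0 / 2 * z ^ 2))).im = 0 := by
    have : I * μ * ((θ 0 : ℂ) + (ξ 0 : ℂ) * z + Γ 0 / 2 * z ^ 2)
        = ((-(μ * β₀ * (x - X 0) ^ 2 / 2) : ℝ) : ℂ) := by
      rw [hθ0, hξ0, hΓ0, hz]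
      push_cast
      ring_nf
      rw [Complex.I_sq]
      ring
    rw [this, ← Complex.ofReal_exp, Complex.ofReal_im]
  have hPt : (((deriv θ 0 : ℝ) : ℂ) + ((deriv ξ 0 : ℝ) : ℂ) * z - (ξ 0 : ℂ) * ((deriv X 0 : ℝ) : ℂ)
      + deriv Γ 0 / 2 * z ^ 2 - Γ 0 * z * ((deriv X 0 : ℝ) : ℂ)).im = 0 := by
    rw [hξ0, hdX0]
    have hz2 : (z ^ 2).im = 0 := by rw [pow_two, Complex.mul_im, hzim]; ring
    simp only [Complex.add_im, Complex.mul_im, Complex.ofReal_im,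
      Complex.ofReal_re, hzim, hz2, Complex.div_ofNat_im, hdΓ0, Complex.ofReal_zero, zero_mul, mul_zero, add_zero,
      zero_div, sub_zero]
  have hw : (deriv a 0 + I * μ * (((deriv θ 0 : ℝ) : ℂ) + ((deriv ξ 0 : ℝ) : ℂ) * z
      - (ξ 0 : ℂ) * ((deriv X 0 : ℝ) : ℂ) + deriv Γ 0 / 2 * z ^ 2 - Γ 0 * z * ((deriv X 0 : ℝ) : ℂ))
      * a 0).re = 0 := by
    rw [Complex.add_re, hda0, zero_add, mul_assoc, mul_assoc, Complex.I_mul_re, Complex.im_ofReal_mul,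
      Complex.mul_im, hPt, ha0, mul_zero, zero_mul, add_zero, mul_zero, neg_zero]
  have hwE : ((deriv a 0 + I * μ * (((deriv θ 0 : ℝ) : ℂ) + ((deriv ξ 0 : ℝ) : ℂ) * z
      - (ξ 0 : ℂ) * ((deriv X 0 : ℝ) : ℂ) + deriv Γ 0 / 2 * z ^ 2 - Γ 0 * z * ((deriv X 0 : ℝ) : ℂ))
      * a 0) * cexp (I * μ * ((θ 0 : ℂ) + (ξ 0 : ℂ) * z + Γ 0 / 2 * z ^ 2))).re = 0 := by
    rw [Complex.mul_re, hw, hE, zero_mul, mul_zero, sub_zero]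
  rw [hprod.deriv, Complex.reCLM_apply, hwE, hdX0]
  simp

/-! ### The energy of the data from below -/

/-- A non-negative function which is at least `c ≥ 0` on `[α, β]` has `∫⁻ ofReal ≥ c(β − α)`. [folklore] -/
theorem lintegral_ofReal_ge_of_le_on_Icc {f : ℝ → ℝ} {α β c : ℝ} (hc : 0 ≤ c)
    (hS : ∀ x ∈ Icc α β, c ≤ f x) :
    ENNReal.ofReal (c * (β - α)) ≤ ∫⁻ x, ENNReal.ofReal (f x) := by
  calc ENNReal.ofReal (c * (β - α)) = ENNReal.ofReal c * volume (Icc α β) := by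
        rw [Real.volume_Icc, ENNReal.ofReal_mul hc]
    _ = ∫⁻ _ in Icc α β, ENNReal.ofReal c := by rw [setLIntegral_const]
    _ ≤ ∫⁻ x in Icc α β, ENNReal.ofReal (f x) :=
        setLIntegral_mono' measurableSet_Icc fun x hx => ENNReal.ofReal_le_ofReal (hS x hx)
    _ ≤ ∫⁻ x, ENNReal.ofReal (f x) := setLIntegral_le_lintegral _ _

/-- **Potential energy density of the Gaussian datum near its centre.** For `μ ≥ 4/(β₀δ₀²)`
(`β₀, δ₀ > 0`), `χ = 1` on `[−δ₀/2, δ₀/2]` and `q ≥ q₀ ≥ 0` on `[X₀ − δ₀, X₀ + δ₀]`, on the window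
`|x − X₀| ≤ (μβ₀)^{−1/2}` one has `μ² q(x) G(0,x)² ≥ μ² q₀ a₀² e^{−1}`, where
`G(0,x) = χ(x − X₀) a₀ e^{−μβ₀(x−X₀)²/2}`. [folklore] -/
theorem cutBeam_initial_potential_ge {X₀ β₀ q₀ a₀ : ℝ} (hβ₀ : 0 < β₀) (hδ₀ : 0 < δ₀)
    (hμ : 4 / (β₀ * δ₀ ^ 2) ≤ μ) (hq0 : 0 ≤ q₀)
    (hχ1 : ∀ y ∈ Icc (-(δ₀ / 2)) (δ₀ / 2), χ y = 1)
    (hq : ∀ x ∈ Icc (X₀ - δ₀) (X₀ + δ₀), q₀ ≤ q x) {x : ℝ}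
    (hx : x ∈ Icc (X₀ - 1 / Real.sqrt (μ * β₀)) (X₀ + 1 / Real.sqrt (μ * β₀))) :
    μ ^ 2 * q₀ * a₀ ^ 2 * Real.exp (-1)
      ≤ μ ^ 2 * q x * (χ (x - X₀) * a₀ * Real.exp (-(μ * β₀ * (x - X₀) ^ 2 / 2))) ^ 2 := by
  have hμ0 : 0 < μ := lt_of_lt_of_le (by positivity) hμ
  have hs : 0 < Real.sqrt (μ * β₀) := Real.sqrt_pos.2 (by positivity)
  set r : ℝ := 1 / Real.sqrt (μ * β₀) with hr
  have hr0 : 0 < r := by positivity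
  have hrsq : r ^ 2 = 1 / (μ * β₀) := by
    rw [hr, div_pow, one_pow, Real.sq_sqrt (by positivity)]
  -- the window lies inside `{χ = 1}` and inside `[X₀ − δ₀, X₀ + δ₀]`
  have hr2 : r ≤ δ₀ / 2 := by
    have h1 : r ^ 2 ≤ (δ₀ / 2) ^ 2 := by
      rw [hrsq, div_le_iff₀ (by positivity)]
      have : 4 / (β₀ * δ₀ ^ 2) * (β₀ * (δ₀ / 2) ^ 2) = 1 := by field_simp; ring
      nlinarith [mul_le_mul_of_nonneg_right hμ (by positivity : 0 ≤ β₀ * (δ₀ / 2) ^ 2)]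
    nlinarith [h1, hr0, hδ₀]
  have hy : |x - X₀| ≤ r := by
    rw [abs_le]; constructor <;> linarith [hx.1, hx.2]
  have hχx : χ (x - X₀) = 1 := hχ1 _ ⟨by linarith [neg_abs_le (x - X₀)], by linarith [le_abs_self (x - X₀)]⟩
  have hqx : q₀ ≤ q x := hq x ⟨by linarith [neg_abs_le (x - X₀)], by linarith [le_abs_self (x - X₀)]⟩
  -- the Gaussian factor is at least `e^{-1/2}` on the window
  have hexp : Real.exp (-1) ≤ Real.exp (-(μ * β₀ * (x - X₀) ^ 2 / 2)) ^ 2 := by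
    rw [← Real.exp_nat_mul, Real.exp_le_exp]
    push_cast
    have h1 : (x - X₀) ^ 2 ≤ r ^ 2 := by
      have := pow_le_pow_left₀ (abs_nonneg _) hy 2
      rwa [sq_abs] at this
    have h2 : μ * β₀ * (x - X₀) ^ 2 ≤ 1 := by
      calc μ * β₀ * (x - X₀) ^ 2 ≤ μ * β₀ * r ^ 2 := by gcongr
        _ = 1 := by rw [hrsq]; field_simp
    linarith
  rw [hχx, one_mul, mul_pow]
  have h3 : q₀ * (a₀ ^ 2 * Real.exp (-1)) ≤ q x * (a₀ ^ 2 * Real.exp (-(μ * β₀ * (x - X₀) ^ 2 / 2)) ^ 2) :=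
    mul_le_mul hqx (mul_le_mul_of_nonneg_left hexp (sq_nonneg _)) (by positivity) (hq0.trans hqx)
  nlinarith [h3, sq_nonneg μ]

/-! ### The integrated size of the residual -/

/-- `∫ B²μ·𝟙_{[c − δ₀, c + δ₀]} = 2δ₀B²μ`. [folklore] -/
theorem integral_const_indicator_Icc (K c : ℝ) (hδ₀ : 0 ≤ δ₀) :
    ∫ x, Set.indicator (Icc (c - δ₀) (c + δ₀)) (fun _ => K) x = 2 * δ₀ * K := by
  rw [integral_indicator measurableSet_Icc, setIntegral_const, Real.volume_real_Icc_of_le (by linarith)]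
  simp only [smul_eq_mul]
  ring

/-- **Square of the cut-beam residual under the pointwise bound.** If `|R(x)| ≤ B√μ` for all `x`
and `R(x) = 0` for `|x − c| > δ₀` (as for the residual of the cut beam, which vanishes with the
cut-off and its derivatives off `[X t − δ₀, X t + δ₀]`), then
`R² ≤ B²μ · 𝟙_{[c − δ₀, c + δ₀]}` pointwise; in particular `∫ R² ≤ 2δ₀B²μ` for any field whose
residual is `R` (`integral_mono_of_nonneg`, no integrability of `R` needed). [folklore] -/
theorem sq_le_indicator_of_bound {R : ℝ → ℝ} {B c μ : ℝ} (hμ : 0 ≤ μ) (hδ₀ : 0 ≤ δ₀)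
    (hB : ∀ x, |R x| ≤ B * Real.sqrt μ) (h0 : ∀ x, δ₀ < |x - c| → R x = 0) (x : ℝ) :
    R x ^ 2 ≤ Set.indicator (Icc (c - δ₀) (c + δ₀)) (fun _ => B ^ 2 * μ) x := by
  by_cases hx : x ∈ Icc (c - δ₀) (c + δ₀)
  · rw [Set.indicator_of_mem hx]
    have h := hB x
    have hB0 : 0 ≤ B * Real.sqrt μ := (abs_nonneg _).trans h
    calc R x ^ 2 = |R x| ^ 2 := (sq_abs _).symm
      _ ≤ (B * Real.sqrt μ) ^ 2 := pow_le_pow_left₀ (abs_nonneg _) h 2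
      _ = B ^ 2 * μ := by rw [mul_pow, Real.sq_sqrt hμ]
  · rw [Set.indicator_of_notMem hx]
    have : δ₀ < |x - c| := by
      rw [mem_Icc, not_and_or, not_le, not_le] at hx
      rcases hx with hx | hx
      · rw [abs_of_neg (by linarith)]; linarith
      · rw [abs_of_pos (by linarith)]; linarith
    rw [h0 x this]; simp

/-- The integral of the square of such a residual is at most `2δ₀B²μ`. [folklore] -/
theorem integral_sq_le_of_bound {R : ℝ → ℝ} {B c μ : ℝ} (hμ : 0 ≤ μ) (hδ₀ : 0 ≤ δ₀)
    (hB : ∀ x, |R x| ≤ B * Real.sqrt μ) (h0 : ∀ x, δ₀ < |x - c| → R x = 0) :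
    ∫ x, R x ^ 2 ≤ 2 * δ₀ * (B ^ 2 * μ) := by
  rw [← integral_const_indicator_Icc (B ^ 2 * μ) c hδ₀]
  refine integral_mono_of_nonneg (Eventually.of_forall fun x => sq_nonneg (R x)) ?_
    (Eventually.of_forall fun x => sq_le_indicator_of_bound hμ hδ₀ hB h0 x)
  exact ((continuous_const (y := B ^ 2 * μ)).integrableOn_Icc).integrable_indicator measurableSet_Icc

end Data

end Literature.Analysis.PDE
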